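import Summits.BirchSwinnertonDyer.BirchSwinnertonDyer.Theorems.GenusKolyvaginAtTwoEquivariantKolyvaginExactAtTwoReductionCyclic
import HarnessLib

/-!
# Route `ByReductionTypeAtTwo`, crux `RankOneAtTwoOffBigImageOddLocal` (stmt-BirchSwinnertonDyer-23716), line
# `refined_kolyvagin_tamagawa_shift_at_two`, stub `stub_sigmaShiftPosDisc`: at a **REGULAR** Kolyvagin prime of index `≥ M` the `2`-part of
# `Ẽ(𝔽_ℓ)` is CYCLIC of order `2^M` — no sign condition on `Δ`

Lead prover `prover-cruxlead-stmt-BirchSwinnertonDyer-23716-g4` (2026-08-28; `--supports` the crux, closes nothing).  Third regular-engine CONSUMER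
(after `…EngineRegularLemma53Rat`, `…EngineRegularKolyvaginPrimeDictionary`).  The sibling route's `GenusExact.ReductionCyclic` (seat `bsd-line-gk2-p3`)
proves McCallum's Lemma 5.3 (i) over `ℚ_ℓ` at `2` — `Ẽ_ℓ(𝔽_ℓ)[2^M] ≅ ℤ/2^M` at a Gross–Kolyvagin prime of Kolyvagin index `≥ M` — from ONE `Δ < 0`
input: `#Ẽ_ℓ(𝔽_ℓ)[2] = 2`, i.e. the Frobenius at `ℓ` (= complex conjugation on `E[2]`, a TRANSPOSITION when `Δ < 0`) fixes exactly one non-zero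
`2`-torsion point.  A REGULAR Frobenius — an involution of `E[2]` moving some point, the engine's primes on the line's `Δ > 0` cell — is a
transposition too, so the whole file ports:

* `natCard_fixed_twoTorsion_eq_two_of_involution` — abstract: an involution `h ∈ Γ_ℚ` of `E[2] ≅ (ℤ/2)²` moving some point fixes exactly `2`
  points (`0` and `h·u − u`; Lagrange);
* `natCard_twoTorsion_reductionAt_eq_two_of_regularFrob` — **`#Ẽ_ℓ(𝔽_ℓ)[2] = 2`** at an odd good prime `ℓ` with a regular Frobenius on `E[2]`
  (transport to the Frobenius of `FrobShape.exists_frobenius_natCard_fixed_eq` through conjugation and inertia, as in the sibling's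
  `natCard_twoTorsion_reductionAt_eq_two_of_frobEqFrobInfty_of_Δ_neg`);
* `isAddCyclic_torsionBy_reductionAt_two_pow_regular`, `natCard_torsionBy_reductionAt_two_pow_dvd_regular`,
  `eq_of_two_torsion_reductionAt_ne_zero_regular`, `twoPower_torsion_reductionAt_comparable_regular`,
  `natCard_torsionBy_reductionAt_two_pow_eq_regular` (**`#Ẽ_ℓ(𝔽_ℓ)[2^M] = 2^M`** for `M ≤ M(ℓ)`), `nonempty_addEquiv_zmod_torsionBy_reductionAt_regular`
  (**`Ẽ_ℓ(𝔽_ℓ)[2^M] ≃+ ZMod (2^M)`**) — the sibling's statements with (`Δ < 0`, `FrobEqFrobInfty`) replaced by the regular datum; proofs verbatim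
  over the new count (the sign-free steps `two_pow_dvd_natCard_reductionAt`, `natCard_torsionBy_eq_of_dvd` are re-used by name).

THEOREMS ONLY (no definition, no named fact, no `sorry`, standard axioms).  BSD is not proved by any of this; the crux is not proved; the stub is
not proved.

References: [McCallumLMS1991] §4, §5 Lemma 5.3; [GrossLMS1991] §3 (3.2)–(3.3); [WZhang2014] Notations (xii); [SilvermanAEC2009] Prop. VII.3.1(b),
Cor. III.6.4(b).
-/

set_option autoImplicit false
set_option linter.dupNamespace false -- tree convention: `Summit.BirchSwinnertonDyer.BirchSwinnertonDyer.Theorems` (summit = sub-problem)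

noncomputable section

open scoped Classical

namespace Summit.BirchSwinnertonDyer.BirchSwinnertonDyer.Theorems.OffBigImageOddLocalAtTwo.Engine

open Polynomial WeierstrassCurve Field NumberField IsDedekindDomain
open Literature.NumberTheory.EllipticCurves Literature.NumberTheory.GaloisRepresentations
open Literature.NumberTheory.EllipticCurves.Rank1Residual
open Summit.BirchSwinnertonDyer.BirchSwinnertonDyer.Theorems.KolyvaginEigenTwo
open Summit.BirchSwinnertonDyer.BirchSwinnertonDyer.Theorems.GenusKolySign
open Summit.BirchSwinnertonDyer.BirchSwinnertonDyer.Theorems.GenusExact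
open Summit.BirchSwinnertonDyer.BirchSwinnertonDyer.Theorems.GenusExact.ReductionCyclic

variable (W : WeierstrassCurve ℚ) [W.IsElliptic]

/-! ## §1 An involution of `E[2]` moving a point fixes exactly two points -/

/-- **An involution `h` of `E[2] ≅ (ℤ/2)²` that moves some point has exactly `2` fixed points** (`0` and `h·u − u`, which is fixed because
`h(hu − u) = u − hu = hu − u` in an elementary abelian `2`-group; the fixed subgroup is proper, and a subgroup of a group of order `4` with two
elements that is not everything has order `2`, Lagrange).  REGULAR = transposition type. [cite: SilvermanAEC2009, Cor. III.6.4(b)] -/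
theorem natCard_fixed_twoTorsion_eq_two_of_involution (h : absoluteGaloisGroup ℚ)
    (hinv : ∀ P : geomTorsion W ((2 : ℕ) : ℤ), h • h • P = P) (hmv : ∃ u : geomTorsion W ((2 : ℕ) : ℤ), h • u ≠ u) :
    Nat.card {P : geomTorsion W ((2 : ℕ) : ℤ) // h • P = P} = 2 := by
  -- `E[2]` has `4` elements, each killed by `2`
  have hcard : Nat.card (geomTorsion W ((2 : ℕ) : ℤ)) = 2 ^ 2 :=
    card_torsionPoints_eq_sq_holds W (AlgebraicClosure ℚ) (n := 2) (by norm_num)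
  haveI : Finite (geomTorsion W ((2 : ℕ) : ℤ)) := Nat.finite_of_card_ne_zero (by rw [hcard]; norm_num)
  have hT2 : ∀ P : geomTorsion W ((2 : ℕ) : ℤ), P + P = 0 := fun P ↦ by
    have := (mem_geomTorsion_iff W ((2 : ℕ) : ℤ) _).mp P.2
    apply Subtype.ext
    rw [AddSubgroup.coe_add, ZeroMemClass.coe_zero, ← two_zsmul]
    exact_mod_cast this
  have hneg : ∀ P : geomTorsion W ((2 : ℕ) : ℤ), -P = P := fun P ↦
    neg_eq_of_add_eq_zero_left (hT2 P)
  -- the fixed subgroup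
  let Fx : AddSubgroup (geomTorsion W ((2 : ℕ) : ℤ)) :=
    { carrier := {P | h • P = P}
      add_mem' := fun {a b} ha hb ↦ by
        change h • (a + b) = a + b
        rw [smul_add, ha, hb]
      zero_mem' := by change h • (0 : geomTorsion W ((2 : ℕ) : ℤ)) = 0; exact smul_zero h
      neg_mem' := fun {a} ha ↦ by
        change h • (-a) = -a
        rw [smul_neg, ha] }
  have hFx : Nat.card {P : geomTorsion W ((2 : ℕ) : ℤ) // h • P = P} = Nat.card Fx := rfl
  rw [hFx]
  -- Lagrange: `#Fx ∣ 4`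
  have hdvd : Nat.card Fx ∣ 2 ^ 2 := hcard ▸ Fx.card_addSubgroup_dvd_card
  obtain ⟨k, hk2, hk⟩ := (Nat.dvd_prime_pow Nat.prime_two).mp hdvd
  -- two distinct fixed points: `0` and `h·u − u`
  obtain ⟨u, hu⟩ := hmv
  set w : geomTorsion W ((2 : ℕ) : ℤ) := h • u - u with hw
  have hw0 : w ≠ 0 := fun h0 ↦ hu (sub_eq_zero.mp h0)
  have hwfix : h • w = w := by
    rw [hw, smul_sub, hinv, ← neg_sub, hneg]
  have h2le : 2 ≤ Nat.card Fx := by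
    let f : Bool → Fx := fun b ↦ if b then ⟨w, hwfix⟩ else ⟨0, Fx.zero_mem⟩
    have hf : Function.Injective f := by
      intro b b' hbb'
      cases b <;> cases b' <;> simp only [f] at hbb' ⊢
      · exact absurd (congrArg Subtype.val hbb').symm hw0
      · exact absurd (congrArg Subtype.val hbb') hw0
    have := Nat.card_le_card_of_injective f hf
    rwa [Nat.card_eq_fintype_card, Fintype.card_bool] at this
  -- `Fx ≠ ⊤`
  have hne4 : Nat.card Fx ≠ 2 ^ 2 := by
    intro h4
    have htop : Fx = ⊤ := AddSubgroup.eq_top_of_card_eq Fx (by rw [h4, hcard])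
    have : u ∈ Fx := htop ▸ AddSubgroup.mem_top u
    exact hu this
  interval_cases k
  · rw [hk] at h2le; norm_num at h2le
  · rw [hk, pow_one]
  · exact absurd hk hne4

/-! ## §2 `#Ẽ_ℓ(𝔽_ℓ)[2] = 2` at a regular Kolyvagin prime -/

variable [W.IsGloballyMinimal]

/-- **`#Ẽ(𝔽_ℓ)[2] = 2` at an odd good prime `ℓ` whose Frobenius is a REGULAR involution of `E[2]`** (`W/ℚ` globally minimal; some arithmetic
Frobenius at some `𝔓 ∣ ℓ` acts on `E[2]` as an involution moving a point — a transposition): the `2`-division cubic has exactly one root mod `ℓ`.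
Transport of the sibling's `natCard_twoTorsion_reductionAt_eq_two_of_frobEqFrobInfty_of_Δ_neg` (`Δ < 0`, `Frob(ℓ) = Frob(∞)`): the fixed points
of the Frobenius of `FrobShape.exists_frobenius_natCard_fixed_eq` are those of `h` up to conjugation and inertia; counted by §1.
[cite: SilvermanAEC2009, Prop. VII.3.1(b), Cor. III.6.4(b)] [cite: GrossLMS1991, §3 (3.2)] -/
theorem natCard_twoTorsion_reductionAt_eq_two_of_regularFrob {ℓ : ℕ} [Fact ℓ.Prime] (hℓ2 : ℓ ≠ 2)
    (hgoodℓ : W.HasGoodReductionAtPrime ℓ)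
    {v : IsDedekindDomain.HeightOneSpectrum (NumberField.RingOfIntegers ℚ)}
    (hv : (ℓ : NumberField.RingOfIntegers ℚ) ∈ v.asIdeal)
    (hreg : ∃ (𝔓 : Ideal (absIntegers (𝓞 ℚ) ℚ)) (h : absoluteGaloisGroup ℚ), 𝔓 ∈ v.primesAbove ∧
      IsArithFrobAt (𝓞 ℚ) h 𝔓 ∧ (∀ P : geomTorsion W ((2 : ℕ) : ℤ), h • h • P = P) ∧
      ∃ u : geomTorsion W ((2 : ℕ) : ℤ), h • u ≠ u) :
    Nat.card (AddSubgroup.torsionBy (W.reductionAt v).toAffine.Point ((2 : ℕ) : ℤ)) = 2 := by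
  haveI : Fact (Nat.Prime 2) := ⟨Nat.prime_two⟩
  have hℓp : ℓ.Prime := Fact.out
  obtain ⟨𝔓, h, h𝔓, hfr, hinv, hmv⟩ := hreg
  have hvℓ : (Rat.HeightOneSpectrum.primesEquiv v : ℕ) = ℓ := primesEquiv_eq_of_natCast_mem hℓp hv
  obtain ⟨σ₀, 𝔓₀, h𝔓₀, hσ₀, hcount⟩ :=
    Summit.BirchSwinnertonDyer.Rank1Residual.GaloisImage.FrobShape.exists_frobenius_natCard_fixed_eq
      W 2 ℓ hℓ2 hgoodℓ hv
  have hc1 := hcount 1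
  rw [pow_one] at hc1
  rw [← hc1]
  obtain ⟨g, hg⟩ := IsDedekindDomain.HeightOneSpectrum.exists_smul_eq_of_mem_primesAbove_holds h𝔓₀ h𝔓
  have hσ₁ : IsArithFrobAt (NumberField.RingOfIntegers ℚ) (g * σ₀ * g⁻¹) 𝔓 := hg ▸ hσ₀.conj g
  have hI := hfr.mul_inv_mem_inertia hσ₁
  have hgood : W.HasGoodReductionAt v := (hasGoodReductionAtPrime_primesEquiv_iff_holds W v ℓ hvℓ).mp hgoodℓ
  have h2v : (2 : NumberField.RingOfIntegers ℚ) ∉ v.asIdeal := fun h2 ↦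
    hℓ2 (hvℓ.symm.trans (primesEquiv_eq_of_natCast_mem Nat.prime_two (by exact_mod_cast h2)))
  have h2v' : ((((2 : ℕ) : ℤ)) : NumberField.RingOfIntegers ℚ) ∉ v.asIdeal := by
    rw [Int.cast_natCast]; exact_mod_cast h2v
  have hσσ₁ : ∀ P : geomTorsion W ((2 : ℕ) : ℤ), h • P = (g * σ₀ * g⁻¹) • P := fun P ↦ by
    have h' := W.smul_geomTorsion_eq_of_mem_inertia hgood h2v' h𝔓 hI ((g * σ₀ * g⁻¹) • P)
    rwa [mul_smul, inv_smul_smul] at h'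
  -- fixed points of `σ₀` ↔ fixed points of `h`, via `P ↦ g • P`
  have hiff : ∀ P : geomTorsion W ((2 : ℕ) : ℤ), σ₀ • P = P ↔ h • (g • P) = g • P := fun P ↦ by
    rw [hσσ₁, mul_smul, mul_smul, inv_smul_smul]
    constructor
    · intro hP; rw [hP]
    · intro hP; exact smul_left_cancel g hP
  have hcongr : Nat.card {P : geomTorsion W ((2 : ℕ) : ℤ) // σ₀ • P = P} =
      Nat.card {P : geomTorsion W ((2 : ℕ) : ℤ) // h • P = P} := by
    refine Nat.card_congr
      { toFun := fun P ↦ ⟨g • P.1, (hiff P.1).mp P.2⟩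
        invFun := fun Q ↦ ⟨g⁻¹ • Q.1, (hiff _).mpr (by rw [smul_inv_smul]; exact Q.2)⟩
        left_inv := fun P ↦ Subtype.ext (inv_smul_smul g P.1)
        right_inv := fun Q ↦ Subtype.ext (smul_inv_smul g Q.1) }
  rw [hcongr]
  exact natCard_fixed_twoTorsion_eq_two_of_involution W h hinv hmv

/-! ## §3 The sibling's cyclicity file, ported verbatim over the regular count -/

/-- **At a regular Kolyvagin prime every `Ẽ_ℓ(𝔽_ℓ)[2^k]` is CYCLIC** (`#Ẽ[2] = 2` + a finite group killed by `2^k` with `≤ 2` elements of order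
`≤ 2` is cyclic, `KolyvaginEigenPow.isAddCyclic_of_card_torsion_le`). [cite: McCallumLMS1991, §5 Lemma 5.3] [cite: SilvermanAEC2009, Prop. VII.3.1(b)] -/
theorem isAddCyclic_torsionBy_reductionAt_two_pow_regular {ℓ : ℕ} [Fact ℓ.Prime] (hℓ2 : ℓ ≠ 2)
    (hgoodℓ : W.HasGoodReductionAtPrime ℓ) {v : HeightOneSpectrum (𝓞 ℚ)} (hv : (ℓ : 𝓞 ℚ) ∈ v.asIdeal)
    (hreg : ∃ (𝔓 : Ideal (absIntegers (𝓞 ℚ) ℚ)) (h : absoluteGaloisGroup ℚ), 𝔓 ∈ v.primesAbove ∧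
      IsArithFrobAt (𝓞 ℚ) h 𝔓 ∧ (∀ P : geomTorsion W ((2 : ℕ) : ℤ), h • h • P = P) ∧
      ∃ u : geomTorsion W ((2 : ℕ) : ℤ), h • u ≠ u) (k : ℕ) :
    IsAddCyclic (AddSubgroup.torsionBy (W.reductionAt v).toAffine.Point ((2 ^ k : ℕ) : ℤ)) := by
  haveI : Finite (W.reductionAt v).toAffine.Point := W.finite_point_reductionAt v
  have h2 := natCard_twoTorsion_reductionAt_eq_two_of_regularFrob W hℓ2 hgoodℓ hv hreg
  set G := AddSubgroup.torsionBy (W.reductionAt v).toAffine.Point ((2 ^ k : ℕ) : ℤ) with hG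
  refine KolyvaginEigenPow.isAddCyclic_of_card_torsion_le (p := 2) (M := k) Nat.prime_two
    (fun g ↦ AddSubgroup.torsionBy.nsmul g) ?_
  have hle : Nat.card {g : G // 2 • g = 0} ≤
      Nat.card (AddSubgroup.torsionBy (W.reductionAt v).toAffine.Point ((2 : ℕ) : ℤ)) := by
    refine Nat.card_le_card_of_injective
      (fun g ↦ ⟨((g.1 : G) : (W.reductionAt v).toAffine.Point),
        AddSubgroup.torsionBy.nsmul_iff.mpr (by
          have h := congrArg Subtype.val g.2
          simpa only [AddSubmonoidClass.coe_nsmul, ZeroMemClass.coe_zero] using h)⟩) ?_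
    intro g g' h
    have h' := congrArg Subtype.val h
    exact Subtype.ext (Subtype.ext h')
  exact hle.trans h2.le

/-- **… hence `#Ẽ_ℓ(𝔽_ℓ)[2^k] ∣ 2^k`** at a regular Kolyvagin prime. [cite: McCallumLMS1991, §5 Lemma 5.3] -/
theorem natCard_torsionBy_reductionAt_two_pow_dvd_regular {ℓ : ℕ} [Fact ℓ.Prime] (hℓ2 : ℓ ≠ 2)
    (hgoodℓ : W.HasGoodReductionAtPrime ℓ) {v : HeightOneSpectrum (𝓞 ℚ)} (hv : (ℓ : 𝓞 ℚ) ∈ v.asIdeal)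
    (hreg : ∃ (𝔓 : Ideal (absIntegers (𝓞 ℚ) ℚ)) (h : absoluteGaloisGroup ℚ), 𝔓 ∈ v.primesAbove ∧
      IsArithFrobAt (𝓞 ℚ) h 𝔓 ∧ (∀ P : geomTorsion W ((2 : ℕ) : ℤ), h • h • P = P) ∧
      ∃ u : geomTorsion W ((2 : ℕ) : ℤ), h • u ≠ u) (k : ℕ) :
    Nat.card (AddSubgroup.torsionBy (W.reductionAt v).toAffine.Point ((2 ^ k : ℕ) : ℤ)) ∣ 2 ^ k := by
  haveI : Finite (W.reductionAt v).toAffine.Point := W.finite_point_reductionAt v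
  haveI := isAddCyclic_torsionBy_reductionAt_two_pow_regular W hℓ2 hgoodℓ hv hreg k
  rw [← IsAddCyclic.exponent_eq_card]
  exact AddMonoid.exponent_dvd_of_forall_nsmul_eq_zero fun g ↦ AddSubgroup.torsionBy.nsmul g

/-- **At most one point of order `2`** in `Ẽ_ℓ(𝔽_ℓ)` at a regular Kolyvagin prime. [cite: SilvermanAEC2009, Prop. VII.3.1(b)] -/
theorem eq_of_two_torsion_reductionAt_ne_zero_regular {ℓ : ℕ} [Fact ℓ.Prime] (hℓ2 : ℓ ≠ 2)
    (hgoodℓ : W.HasGoodReductionAtPrime ℓ) {v : HeightOneSpectrum (𝓞 ℚ)} (hv : (ℓ : 𝓞 ℚ) ∈ v.asIdeal)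
    (hreg : ∃ (𝔓 : Ideal (absIntegers (𝓞 ℚ) ℚ)) (h : absoluteGaloisGroup ℚ), 𝔓 ∈ v.primesAbove ∧
      IsArithFrobAt (𝓞 ℚ) h 𝔓 ∧ (∀ P : geomTorsion W ((2 : ℕ) : ℤ), h • h • P = P) ∧
      ∃ u : geomTorsion W ((2 : ℕ) : ℤ), h • u ≠ u)
    {P Q : (W.reductionAt v).toAffine.Point} (hP : (2 : ℤ) • P = 0) (hQ : (2 : ℤ) • Q = 0)
    (hP0 : P ≠ 0) (hQ0 : Q ≠ 0) : P = Q := by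
  have h2 := natCard_twoTorsion_reductionAt_eq_two_of_regularFrob W hℓ2 hgoodℓ hv hreg
  rw [Nat.card_eq_two_iff] at h2
  obtain ⟨x, y, hxy, huniv⟩ := h2
  have hmem : ∀ z : AddSubgroup.torsionBy (W.reductionAt v).toAffine.Point ((2 : ℕ) : ℤ),
      z = x ∨ z = y := fun z ↦ by
    have hz : z ∈ ({x, y} : Set _) := by rw [huniv]; exact Set.mem_univ z
    simpa using hz
  have hP' : P ∈ AddSubgroup.torsionBy (W.reductionAt v).toAffine.Point ((2 : ℕ) : ℤ) := by
    simpa using hP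
  have hQ' : Q ∈ AddSubgroup.torsionBy (W.reductionAt v).toAffine.Point ((2 : ℕ) : ℤ) := by
    simpa using hQ
  have h0 : (0 : (W.reductionAt v).toAffine.Point) ∈
      AddSubgroup.torsionBy (W.reductionAt v).toAffine.Point ((2 : ℕ) : ℤ) := zero_mem _
  rcases hmem ⟨0, h0⟩ with h0x | h0y
  · rcases hmem ⟨P, hP'⟩ with hPx | hPy
    · exact absurd (congrArg Subtype.val (hPx.trans h0x.symm)) hP0
    · rcases hmem ⟨Q, hQ'⟩ with hQx | hQy
      · exact absurd (congrArg Subtype.val (hQx.trans h0x.symm)) hQ0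
      · exact congrArg Subtype.val (hPy.trans hQy.symm)
  · rcases hmem ⟨P, hP'⟩ with hPx | hPy
    · rcases hmem ⟨Q, hQ'⟩ with hQx | hQy
      · exact congrArg Subtype.val (hPx.trans hQx.symm)
      · exact absurd (congrArg Subtype.val (hQy.trans h0y.symm)) hQ0
    · exact absurd (congrArg Subtype.val (hPy.trans h0y.symm)) hP0

/-- **The `2`-primary part of `Ẽ_ℓ(𝔽_ℓ)` is a CHAIN** at a regular Kolyvagin prime (g9's comparability lemma with the trivial involution).
[cite: McCallumLMS1991, §5 Lemma 5.3] -/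
theorem twoPower_torsion_reductionAt_comparable_regular {ℓ : ℕ} [Fact ℓ.Prime] (hℓ2 : ℓ ≠ 2)
    (hgoodℓ : W.HasGoodReductionAtPrime ℓ) {v : HeightOneSpectrum (𝓞 ℚ)} (hv : (ℓ : 𝓞 ℚ) ∈ v.asIdeal)
    (hreg : ∃ (𝔓 : Ideal (absIntegers (𝓞 ℚ) ℚ)) (h : absoluteGaloisGroup ℚ), 𝔓 ∈ v.primesAbove ∧
      IsArithFrobAt (𝓞 ℚ) h 𝔓 ∧ (∀ P : geomTorsion W ((2 : ℕ) : ℤ), h • h • P = P) ∧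
      ∃ u : geomTorsion W ((2 : ℕ) : ℤ), h • u ≠ u)
    (k : ℕ) (s t : (W.reductionAt v).toAffine.Point) (hs : (2 : ℤ) ^ k • s = 0)
    (ht : (2 : ℤ) ^ k • t = 0) : (∃ n : ℤ, s = n • t) ∨ ∃ n : ℤ, t = n • s :=
  Gorenstein.fixed_comparable_of_unique_fixed_involution (AddMonoidHom.id _)
    (fun _ _ hu hw _ _ hu0 hw0 ↦
      eq_of_two_torsion_reductionAt_ne_zero_regular W hℓ2 hgoodℓ hv hreg hu hw hu0 hw0)
    k s t hs ht rfl rfl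

/-- **`#Ẽ_ℓ(𝔽_ℓ)[2^M] = 2^M` at a regular Kolyvagin prime of Kolyvagin index `≥ M`** (`2^M ∣ ℓ + 1`, `2^M ∣ a_ℓ`: the sign-free
`two_pow_dvd_natCard_reductionAt` + `natCard_torsionBy_eq_of_dvd` of the sibling file) — McCallum's Lemma 5.3 (i) «cyclic groups of order
`p^M`» for `E(ℚ_ℓ)[2^∞] ≅ Ẽ_ℓ(𝔽_ℓ)[2^∞]` at `2`, reduction side, on EITHER sign of `Δ`. [cite: McCallumLMS1991, §5 Lemma 5.3]
[cite: WZhang2014, Notations (xii)] -/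
theorem natCard_torsionBy_reductionAt_two_pow_eq_regular {ℓ : ℕ} [Fact ℓ.Prime] (hℓ2 : ℓ ≠ 2)
    (hgoodℓ : W.HasGoodReductionAtPrime ℓ) {v : HeightOneSpectrum (𝓞 ℚ)} (hv : (ℓ : 𝓞 ℚ) ∈ v.asIdeal)
    (hreg : ∃ (𝔓 : Ideal (absIntegers (𝓞 ℚ) ℚ)) (h : absoluteGaloisGroup ℚ), 𝔓 ∈ v.primesAbove ∧
      IsArithFrobAt (𝓞 ℚ) h 𝔓 ∧ (∀ P : geomTorsion W ((2 : ℕ) : ℤ), h • h • P = P) ∧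
      ∃ u : geomTorsion W ((2 : ℕ) : ℤ), h • u ≠ u)
    {M : ℕ} (hM : M ≤ Zhang2014.kolyvaginIndex W 2 ℓ) :
    Nat.card (AddSubgroup.torsionBy (W.reductionAt v).toAffine.Point ((2 ^ M : ℕ) : ℤ)) = 2 ^ M := by
  haveI : Finite (W.reductionAt v).toAffine.Point := W.finite_point_reductionAt v
  exact natCard_torsionBy_eq_of_dvd (natCard_torsionBy_reductionAt_two_pow_dvd_regular W hℓ2 hgoodℓ hv hreg M)
    (two_pow_dvd_natCard_reductionAt W Fact.out hM hv)

/-- **… and it is cyclic of order `2^M`**: `Ẽ_ℓ(𝔽_ℓ)[2^M] ≃+ ZMod (2^M)` at a regular Kolyvagin prime of index `≥ M`.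
[cite: McCallumLMS1991, §5 Lemma 5.3] -/
theorem nonempty_addEquiv_zmod_torsionBy_reductionAt_regular {ℓ : ℕ} [Fact ℓ.Prime] (hℓ2 : ℓ ≠ 2)
    (hgoodℓ : W.HasGoodReductionAtPrime ℓ) {v : HeightOneSpectrum (𝓞 ℚ)} (hv : (ℓ : 𝓞 ℚ) ∈ v.asIdeal)
    (hreg : ∃ (𝔓 : Ideal (absIntegers (𝓞 ℚ) ℚ)) (h : absoluteGaloisGroup ℚ), 𝔓 ∈ v.primesAbove ∧
      IsArithFrobAt (𝓞 ℚ) h 𝔓 ∧ (∀ P : geomTorsion W ((2 : ℕ) : ℤ), h • h • P = P) ∧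
      ∃ u : geomTorsion W ((2 : ℕ) : ℤ), h • u ≠ u)
    {M : ℕ} (hM : M ≤ Zhang2014.kolyvaginIndex W 2 ℓ) :
    Nonempty (AddSubgroup.torsionBy (W.reductionAt v).toAffine.Point ((2 ^ M : ℕ) : ℤ) ≃+ ZMod (2 ^ M)) := by
  haveI : Finite (W.reductionAt v).toAffine.Point := W.finite_point_reductionAt v
  haveI := isAddCyclic_torsionBy_reductionAt_two_pow_regular W hℓ2 hgoodℓ hv hreg M
  have hcard := natCard_torsionBy_reductionAt_two_pow_eq_regular W hℓ2 hgoodℓ hv hreg hM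
  exact ⟨(hcard ▸ (zmodAddCyclicAddEquiv inferInstance).symm :)⟩

end Summit.BirchSwinnertonDyer.BirchSwinnertonDyer.Theorems.OffBigImageOddLocalAtTwo.Engine

end
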